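import Literature.AlgebraicGeometry.Resolution.InseparableLocalUniformizationWeakConclusion
import Literature.AlgebraicGeometry.Resolution.PurelyInseparableCompositum
import Literature.AlgebraicGeometry.Resolution.SmoothNormalizationConstants
import Literature.AlgebraicGeometry.Resolution.NormalizationOfVarietiesProofs
import Literature.AlgebraicGeometry.Resolution.SmoothUniformization
import Literature.AlgebraicGeometry.Resolution.ValuationRingOpenInNormalizationProofs
import Literature.AlgebraicGeometry.Resolution.InseparableLocalUniformizationDescent
import Mathlib.FieldTheory.PurelyInseparable.PerfectClosure
import HarnessLib

/-!
# Inseparable local uniformization: the final enlargement of `l` (simple smooth centres)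

Topic: `Literature/AlgebraicGeometry/Resolution`. M. Temkin, *Inseparable local uniformization*,
J. Algebra 373 (2013) 65–119 = arXiv:0804.1554v3, proof of Thm. 4.1.1, last sentence of Step 4
(p. 49): "In particular, `x₁` is `l`-smooth, and, replacing `l` with a purely inseparable
extension, we can also arrange that `x₁` is a simple `l`-smooth point" (a smooth point `x` of
an `l`-variety being *simple* if `k(x)/l` is separable, p. 4). We PROVE this sentence in the
tree's vocabulary:

* `descentConclusion_of_isSmoothAt` — from the data of the weak conclusion of Thm. 4.1.1 with
  the base field `l` and the normalization `N = Nr_{L₁}(X′)` given as abstract types (an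
  `l`-smooth centre `x₁` of `L₁°` on `N`), the full conclusion `Temkin2013DescentConclusion`
  (centre `l′`-smooth, SIMPLE and regular for an enlarged `l′`).
* `Temkin2013DescentConclusion.of_weak` — the weak conclusion
  (`Temkin2013DescentConclusionWeak`, `InseparableLocalUniformizationWeakConclusion.lean`)
  implies the full one.

Proof. Let `κ = k(x₁)`, a finitely generated extension of `l`. Choose a finite purely
inseparable `l₀/l` such that every compositum of `κ` with `l₀` is separable over `l₀`
(`exists_purelyInseparable_formallySmooth_compositum`, the separating-transcendence-basis
theorem). Put `L₁′ = L₁·l₀` (`Compositum`), `l′ = l₀`, `L′ = K(L, l₀)`, keep `X′`, extend `L₁°`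
to `L₁′`, and let `N′ = Nr_{L₁′}(X′) = Nr_{L₁′}(N·l₀)` with centre `x₁′`. The base change
`l₀ ⊗_l N` is `l₀`-smooth at its prime `Q` over `x₁` (`isSmoothAt_baseChange`) with residue
field `κ·l₀` separable over `l₀` (`formallySmooth_residueField_baseChange_of_compositum`), and
`N′` has at `x₁′` the local ring of `l₀ ⊗_l N` at `Q`
(`exists_algEquiv_localization_of_map_one_tmul`, `SmoothNormalizationConstants.lean`: the nil
kernel of `l₀ ⊗_l N → L₁′` dies in the regular local ring `(l₀ ⊗ N)_Q`, which is then a normal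
local domain between `N·l₀` and `L₁′ = Frac(N·l₀)`), so `x₁′` is `l₀`-smooth with separable
residue field, and regular (smooth over a field ⇒ regular, `isRegularLocalRing_of_isSmoothAt`).

## Sources

* M. Temkin, *Inseparable local uniformization*, arXiv:0804.1554v3, Thm. 4.1.1 and its proof,
  Step 4 (pp. 47–49); p. 4.

## Design note

The work is done in `descentConclusion_of_isSmoothAt` with `l` and `N` ABSTRACT (plain types
with structure maps) rather than an `IntermediateField`/`Subalgebra`: the coerced types carry
several definitionally-equal-but-distinct instance paths, which makes unification of the
generic compositum lemmas prohibitively slow; `of_weak` only instantiates.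
-/

noncomputable section

open IsLocalRing TensorProduct

namespace Literature.AlgebraicGeometry.Resolution

universe u

variable {k K : Type u} [Field k] [Field K] [Algebra k K]

set_option maxHeartbeats 800000 in
-- one long bookkeeping proof through the tower `k ⊆ K ⊆ K₁ ⊆ L₁ ⊆ L₁·l₀`
/-- **The final enlargement of `l`, abstract form** (Temkin 2013, proof of Thm. 4.1.1, end of
Step 4, p. 49). Data: `K₁ ⊆ L₁` finite purely inseparable over `K`-fields, `l` a finite purely
inseparable extension of `k` mapping into an intermediate field `L` of `L₁/K` which is purely
inseparable over `K` with `K₁[L] = L₁`, an affine refinement `X′ = Spec A′` of `X = Spec A`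
inside `K°`, a valuation ring `L₁°` over `K₁°`, and an `l`-algebra `N` of finite type over `k`
embedded in `L₁` with `Frac N = L₁`, image the integral closure of (the image of) `A′`,
contained in `L₁°`, whose centre `x₁` (a prime `x` of `N`, the preimage of `𝔪_{L₁°}`) is an
`l`-SMOOTH point. Conclusion: `Temkin2013DescentConclusion k K K° A K₁ K₁°` — after enlarging
`l` the centre is `l`-smooth, simple and regular. PROVED (module docstring).
[cite: Temkin2013, proof of Thm. 4.1.1 Step 4 (arXiv:0804.1554v3 p. 49)] -/
theorem descentConclusion_of_isSmoothAt (O : ValuationSubring K) (A : Subalgebra k K)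
    (K₁ : Type u) [Field K₁] [Algebra K K₁] (O₁ : ValuationSubring K₁)
    (L₁ : Type u) [Field L₁] [Algebra K₁ L₁] [Algebra K L₁] [Algebra k L₁]
    [IsScalarTower K K₁ L₁] [IsScalarTower k K L₁] [FiniteDimensional K₁ L₁]
    [IsPurelyInseparable K₁ L₁]
    (lF : Type u) [Field lF] [Algebra k lF] [Algebra lF L₁] [IsScalarTower k lF L₁]
    [FiniteDimensional k lF] [IsPurelyInseparable k lF]
    (L : IntermediateField K L₁) (hlL : Set.range (algebraMap lF L₁) ⊆ L)
    (hLpi : IsPurelyInseparable K L) (hadj : Algebra.adjoin K₁ (L : Set L₁) = ⊤)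
    (A' : Subalgebra k K) (hAA' : A ≤ A') (hA'O : A'.toSubring ≤ O.toSubring) (hA'fg : A'.FG)
    (hA'fr : IsFractionRing A' K)
    (O₁' : ValuationSubring L₁) (hO₁' : O₁'.comap (algebraMap K₁ L₁) = O₁)
    (T : Type u) [CommRing T] [IsDomain T] [Algebra lF T] [Algebra T L₁] [Algebra k T]
    [IsScalarTower k lF T] [IsScalarTower lF T L₁] [IsScalarTower k T L₁]
    [Algebra.FiniteType k T] [IsFractionRing T L₁]
    (hTcar : Set.range (algebraMap T L₁) =
      {y : L₁ | IsIntegral (A'.map (IsScalarTower.toAlgHom k K L₁)) y})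
    (hTO : ∀ t : T, algebraMap T L₁ t ∈ O₁')
    (x : Ideal T) [x.IsPrime]
    (hx : ∀ t : T, t ∈ x ↔ (⟨algebraMap T L₁ t, hTO t⟩ : O₁') ∈ maximalIdeal O₁')
    (hsm : Algebra.IsSmoothAt lF x) :
    Temkin2013DescentConclusion k K O A K₁ O₁ := by
  classical
  -- exponential characteristic
  obtain ⟨q, hq⟩ := ExpChar.exists k
  haveI : ExpChar K q := expChar_of_injective_algebraMap (algebraMap k K).injective q
  haveI : ExpChar lF q := expChar_of_injective_algebraMap (algebraMap k lF).injective q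
  haveI : ExpChar L₁ q := expChar_of_injective_algebraMap (algebraMap K L₁).injective q
  haveI : FaithfulSMul T L₁ := inferInstance
  ------------------------------------------------------------------
  -- the residue field `κ` of the centre, and the choice of `l₀`
  ------------------------------------------------------------------
  haveI : Algebra.FiniteType lF T := Algebra.FiniteType.of_restrictScalars_finiteType k lF T
  haveI : Algebra.FinitePresentation lF T := (Algebra.FinitePresentation.of_finiteType).mp ‹_›
  haveI := hsm
  have hfgκ : (⊤ : IntermediateField lF x.ResidueField).FG := by
    haveI : Algebra.EssFiniteType lF x.ResidueField :=
      Algebra.EssFiniteType.comp lF T x.ResidueField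
    exact IntermediateField.fg_top_iff.mpr this
  obtain ⟨l₀, _, _, hl₀fin, hl₀pi, hsep⟩ :=
    exists_purelyInseparable_formallySmooth_compositum lF x.ResidueField hfgκ
  haveI := hl₀fin
  haveI := hl₀pi
  haveI : Algebra.IsAlgebraic lF l₀ := inferInstance
  ------------------------------------------------------------------
  -- the compositum `C = L₁·l₀` and its structures over `k ⊆ K ⊆ K₁ ⊆ L₁`
  ------------------------------------------------------------------
  let C := Compositum lF L₁ l₀
  haveI : IsScalarTower K₁ L₁ C := inferInstance
  haveI : IsScalarTower K L₁ C := inferInstance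
  haveI : IsScalarTower K K₁ C := inferInstance
  haveI : IsScalarTower k L₁ C := inferInstance
  haveI : IsScalarTower k K C := inferInstance
  haveI : IsScalarTower lF l₀ C := inferInstance
  haveI : IsScalarTower lF L₁ C := inferInstance
  have hll₀C : ∀ c : lF, algebraMap l₀ C (algebraMap lF l₀ c) = algebraMap L₁ C (algebraMap lF L₁ c) :=
    fun c => by
      rw [← IsScalarTower.algebraMap_apply lF l₀ C, ← IsScalarTower.algebraMap_apply lF L₁ C]
  letI algkl₀ : Algebra k l₀ := ((algebraMap lF l₀).comp (algebraMap k lF)).toAlgebra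
  haveI : IsScalarTower k lF l₀ := IsScalarTower.of_algebraMap_eq fun _ => rfl
  haveI : IsScalarTower k l₀ C := IsScalarTower.of_algebraMap_eq fun c => by
    change algebraMap k C c = algebraMap l₀ C (algebraMap lF l₀ (algebraMap k lF c))
    rw [hll₀C, ← IsScalarTower.algebraMap_apply k lF L₁, ← IsScalarTower.algebraMap_apply k L₁ C]
  haveI : FiniteDimensional k l₀ := Module.Finite.trans lF l₀
  haveI : IsPurelyInseparable k l₀ := IsPurelyInseparable.trans k lF l₀
  ------------------------------------------------------------------
  -- `T → C`, the multiplication map `ψ : l₀ ⊗_l T → C` and the normalization `N⋆`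
  ------------------------------------------------------------------
  -- (`C` is a `T`-algebra through `L₁`, by Mathlib's instances on tensor products/quotients)
  haveI : IsScalarTower T L₁ C := inferInstance
  have halgTC : ∀ t : T, algebraMap T C t = algebraMap L₁ C (algebraMap T L₁ t) := fun t =>
    IsScalarTower.algebraMap_apply T L₁ C t
  haveI : IsScalarTower lF T C := IsScalarTower.of_algebraMap_eq fun c => by
    rw [halgTC, ← IsScalarTower.algebraMap_apply lF T L₁, ← IsScalarTower.algebraMap_apply lF L₁ C]
  haveI : IsScalarTower k T C := IsScalarTower.of_algebraMap_eq fun c => by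
    rw [halgTC, ← IsScalarTower.algebraMap_apply k T L₁, ← IsScalarTower.algebraMap_apply k L₁ C]
  haveI : FaithfulSMul T C := (faithfulSMul_iff_algebraMap_injective T C).mpr
    ((algebraMap L₁ C).injective.comp (FaithfulSMul.algebraMap_injective T L₁))
  let ψ : l₀ ⊗[lF] T →ₐ[l₀] C :=
    Algebra.TensorProduct.lift (Algebra.ofId l₀ C) (IsScalarTower.toAlgHom lF T C)
      fun _ _ => Commute.all _ _
  have hψtmul : ∀ (c : l₀) (t : T), ψ (c ⊗ₜ[lF] t) = algebraMap l₀ C c * algebraMap T C t :=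
    fun c t => by
      simp [ψ, Algebra.TensorProduct.lift_tmul, Algebra.ofId_apply]
  have hψ : ∀ t : T, ψ ((1 : l₀) ⊗ₜ[lF] t) = algebraMap T C t := fun t => by
    rw [hψtmul, map_one, one_mul]
  have hl₀int : ∀ c : l₀, IsIntegral T (algebraMap l₀ C c) := fun c => by
    have h1 : IsIntegral lF c := Algebra.IsIntegral.isIntegral c
    have h2 : IsIntegral lF (algebraMap l₀ C c) := h1.algebraMap
    exact h2.tower_top
  let Nstar : Subalgebra l₀ C :=
    { carrier := {z | IsIntegral T z}
      mul_mem' := fun ha hb => ha.mul hb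
      one_mem' := isIntegral_one
      add_mem' := fun ha hb => ha.add hb
      zero_mem' := isIntegral_zero
      algebraMap_mem' := hl₀int }
  have hmemNstar : ∀ z : C, z ∈ Nstar ↔ IsIntegral T z := fun _ => Iff.rfl
  have hψN : ∀ z, ψ z ∈ Nstar := by
    intro z
    induction z using TensorProduct.induction_on with
    | zero => rw [map_zero]; exact Subalgebra.zero_mem _
    | tmul c t =>
      rw [hψtmul]
      exact Subalgebra.mul_mem _ (hl₀int c) ((hmemNstar _).mpr isIntegral_algebraMap)
    | add z₁ z₂ h₁ h₂ => rw [map_add]; exact Subalgebra.add_mem _ h₁ h₂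
  have hNint : ∀ n ∈ Nstar, IsIntegral T n := fun _ hn => hn
  -- `C = Frac(N·l₀)`
  have hfrac : ∀ e : C, ∃ a b : l₀ ⊗[lF] T, ψ b ≠ 0 ∧ e * ψ b = ψ a := by
    let S : Subalgebra L₁ C :=
      { carrier := {e | ∃ a b : l₀ ⊗[lF] T, ψ b ≠ 0 ∧ e * ψ b = ψ a}
        mul_mem' := by
          rintro e₁ e₂ ⟨a₁, b₁, hb₁, h₁⟩ ⟨a₂, b₂, hb₂, h₂⟩
          refine ⟨a₁ * a₂, b₁ * b₂, ?_, ?_⟩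
          · rw [map_mul]; exact mul_ne_zero hb₁ hb₂
          · rw [map_mul, map_mul, ← h₁, ← h₂]; ring
        one_mem' := ⟨1, 1, by rw [map_one]; exact one_ne_zero, by rw [map_one, one_mul]⟩
        add_mem' := by
          rintro e₁ e₂ ⟨a₁, b₁, hb₁, h₁⟩ ⟨a₂, b₂, hb₂, h₂⟩
          refine ⟨a₁ * b₂ + a₂ * b₁, b₁ * b₂, ?_, ?_⟩
          · rw [map_mul]; exact mul_ne_zero hb₁ hb₂
          · rw [map_mul, map_add, map_mul, map_mul, ← h₁, ← h₂]; ring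
        zero_mem' := ⟨0, 1, by rw [map_one]; exact one_ne_zero, by rw [map_zero, zero_mul]⟩
        algebraMap_mem' := fun y => by
          obtain ⟨n, d, hd, hy⟩ := IsFractionRing.div_surjective (A := T) y
          have hd0 : d ≠ 0 := nonZeroDivisors.ne_zero hd
          refine ⟨(1 : l₀) ⊗ₜ[lF] n, (1 : l₀) ⊗ₜ[lF] d, ?_, ?_⟩
          · rw [hψ]
            exact (map_ne_zero_iff _ (FaithfulSMul.algebraMap_injective T C)).mpr hd0
          · rw [hψ, hψ, halgTC, halgTC, ← map_mul, ← hy]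
            congr 1
            have hd0' : algebraMap T L₁ d ≠ 0 :=
              (map_ne_zero_iff _ (FaithfulSMul.algebraMap_injective T L₁)).mpr hd0
            exact div_mul_cancel₀ _ hd0' }
    have hgen : Algebra.adjoin L₁ (Set.range (algebraMap l₀ C)) ≤ S := by
      refine Algebra.adjoin_le ?_
      rintro _ ⟨c, rfl⟩
      refine ⟨c ⊗ₜ[lF] (1 : T), 1, by rw [map_one]; exact one_ne_zero, ?_⟩
      rw [map_one, mul_one, hψtmul, map_one, mul_one]
    intro e
    have he : e ∈ S := hgen (by rw [Compositum.adjoin_range_eq_top]; exact Algebra.mem_top)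
    exact he
  ------------------------------------------------------------------
  -- the valuation ring `L₁′°` extending `L₁°`, and the centres
  ------------------------------------------------------------------
  obtain ⟨Ostar, hOstar⟩ := exists_valuationSubring_comap_eq (F := L₁) (Ω := C) O₁'
  have hTstar : ∀ t : T, algebraMap T C t ∈ Ostar := fun t => by
    rw [halgTC]
    have : algebraMap T L₁ t ∈ Ostar.comap (algebraMap L₁ C) := by rw [hOstar]; exact hTO t
    exact this
  have hNO : Nstar.toSubring ≤ Ostar.toSubring := by
    intro z hz
    have hz' : IsIntegral T z := hz
    letI : Algebra T Ostar := ((algebraMap T C).codRestrict Ostar.toSubring hTstar).toAlgebra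
    haveI : IsScalarTower T Ostar C := IsScalarTower.of_algebraMap_eq fun _ => rfl
    have hz'' : IsIntegral Ostar z := hz'.tower_top
    obtain ⟨y, hy⟩ := IsIntegrallyClosed.algebraMap_eq_of_integral hz''
    rw [← hy]
    exact y.2
  set P : Ideal Nstar := centreIdeal Nstar Ostar hNO with hPdef
  set ψN : l₀ ⊗[lF] T →ₐ[l₀] Nstar := ψ.codRestrict Nstar hψN with hψNdef
  set Q : Ideal (l₀ ⊗[lF] T) := P.comap ψN.toRingHom with hQdef
  have hQx : Q.comap (Algebra.TensorProduct.includeRight (R := lF) (A := l₀) :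
      T →ₐ[lF] l₀ ⊗[lF] T).toRingHom = x := by
    ext z
    rw [hx z]
    change (Subring.inclusion hNO (ψN ((1 : l₀) ⊗ₜ[lF] z))) ∈ maximalIdeal Ostar ↔ _
    rw [ValuationSubring.valuation_lt_one_iff, ValuationSubring.valuation_lt_one_iff]
    change Ostar.valuation (ψ ((1 : l₀) ⊗ₜ[lF] z)) < 1 ↔ O₁'.valuation (algebraMap T L₁ z) < 1
    rw [hψ, halgTC]
    exact valuation_algebraMap_lt_one_iff hOstar (algebraMap T L₁ z)
  ------------------------------------------------------------------
  -- smoothness: `l₀ ⊗ T` at `Q`, then `N⋆` at `P`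
  ------------------------------------------------------------------
  haveI hsmQ : Algebra.IsSmoothAt l₀ Q := isSmoothAt_baseChange (R := lF) (S := T) l₀ x Q hQx
  have hsepQ : Algebra.FormallySmooth l₀ (ResidueField (Localization.AtPrime Q)) :=
    formallySmooth_residueField_baseChange_of_compositum T Q x hQx.symm hsep
  have hsmP : Algebra.IsSmoothAt l₀ P :=
    isSmoothAt_of_map_one_tmul ψ hψ Nstar hψN hNint hfrac P hsmQ
  have hregP : IsRegularLocalRing (Localization.AtPrime P) :=
    isRegularLocalRing_of_map_one_tmul ψ hψ Nstar hψN hNint hfrac P hsmQ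
  have hsepP : Algebra.FormallySmooth l₀ (ResidueField (Localization.AtPrime P)) :=
    formallySmooth_residueField_of_map_one_tmul ψ hψ Nstar hψN hNint hfrac P hsmQ hsepQ
  ------------------------------------------------------------------
  -- packaging: `L₁′ = C`, `l′ = l₀ ⊆ C`, `L′ = K(L, l₀)`, `X′`, `L₁′° = Ostar`, `N′ = N⋆`
  ------------------------------------------------------------------
  haveI : FiniteDimensional L₁ C := inferInstance
  haveI hfinC : FiniteDimensional K₁ C := Module.Finite.trans L₁ C
  haveI : IsPurelyInseparable L₁ C := inferInstance
  have hpiC : IsPurelyInseparable K₁ C := IsPurelyInseparable.trans K₁ L₁ C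
  -- `l′`: the image of `l₀` in `C`
  let ι₀ : l₀ →ₐ[k] C := IsScalarTower.toAlgHom k l₀ C
  have hι₀ : ∀ c : l₀, ι₀ c = algebraMap l₀ C c := fun _ => rfl
  let lnew : IntermediateField k C := ι₀.fieldRange
  have hmem_lnew : ∀ z : C, z ∈ lnew ↔ ∃ c : l₀, algebraMap l₀ C c = z := fun z =>
    AlgHom.mem_fieldRange
  let eι : l₀ →ₐ[k] lnew.toSubalgebra :=
    ι₀.codRestrict lnew.toSubalgebra fun c => (hmem_lnew _).mpr ⟨c, rfl⟩
  have heι : Function.Bijective eι := by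
    constructor
    · intro a b hab
      have := congrArg (fun w : lnew.toSubalgebra => (w : C)) hab
      exact (algebraMap l₀ C).injective this
    · rintro ⟨z, hz⟩
      obtain ⟨c, rfl⟩ := (hmem_lnew z).mp hz
      exact ⟨c, rfl⟩
  let e_l : l₀ ≃ₐ[k] lnew := AlgEquiv.ofBijective eι heι
  have he_l : ∀ c : l₀, ((e_l c : lnew) : C) = algebraMap l₀ C c := fun _ => rfl
  haveI hfin_lnew : FiniteDimensional k lnew := LinearEquiv.finiteDimensional e_l.toLinearEquiv
  have hpi_lnew : IsPurelyInseparable k lnew := e_l.isPurelyInseparable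
  -- `L′ = K(L, l₀)`
  let G : Set C := (algebraMap L₁ C) '' (L : Set L₁) ∪ Set.range (algebraMap l₀ C)
  let Lnew : IntermediateField K C := IntermediateField.adjoin K G
  have hlLnew : (lnew : Set C) ⊆ (Lnew : Set C) := by
    intro z hz
    obtain ⟨c, rfl⟩ := (hmem_lnew z).mp hz
    exact IntermediateField.subset_adjoin K G (Or.inr ⟨c, rfl⟩)
  have hLnew_pi : IsPurelyInseparable K Lnew := by
    rw [IntermediateField.isPurelyInseparable_adjoin_iff_pow_mem K C q]
    rintro z (⟨s, hs, rfl⟩ | ⟨c, rfl⟩)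
    · obtain ⟨n, y, hy⟩ := IsPurelyInseparable.pow_mem K q (⟨s, hs⟩ : L)
      refine ⟨n, y, ?_⟩
      have hy' : algebraMap K L₁ y = s ^ q ^ n := by
        have := congrArg (fun w : L => (w : L₁)) hy
        simpa using this
      rw [IsScalarTower.algebraMap_apply K L₁ C, hy', map_pow]
    · obtain ⟨n, y, hy⟩ := Compositum.exists_pow_mem_range (κ := lF) (E := L₁) (k' := l₀) q c
      obtain ⟨m, z, hz⟩ :=
        IsPurelyInseparable.pow_mem K q (⟨algebraMap lF L₁ y, hlL ⟨y, rfl⟩⟩ : L)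
      refine ⟨n + m, z, ?_⟩
      have hz' : algebraMap K L₁ z = algebraMap lF L₁ y ^ q ^ m := by
        have := congrArg (fun w : L => (w : L₁)) hz
        simpa using this
      rw [pow_add, pow_mul, hy, ← map_pow, ← hz', ← IsScalarTower.algebraMap_apply K L₁ C]
  have hadj_new : Algebra.adjoin K₁ (Lnew : Set C) = ⊤ := by
    have hL₁ : ∀ y : L₁, algebraMap L₁ C y ∈ Algebra.adjoin K₁ (Lnew : Set C) := by
      intro y
      have hy : y ∈ Algebra.adjoin K₁ (L : Set L₁) := by rw [hadj]; exact Algebra.mem_top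
      have hy' : IsScalarTower.toAlgHom K₁ L₁ C y ∈
          (Algebra.adjoin K₁ (L : Set L₁)).map (IsScalarTower.toAlgHom K₁ L₁ C) :=
        Subalgebra.mem_map.mpr ⟨y, hy, rfl⟩
      rw [AlgHom.map_adjoin] at hy'
      refine Algebra.adjoin_mono ?_ hy'
      rintro _ ⟨s, hs, rfl⟩
      exact IntermediateField.subset_adjoin K G (Or.inl ⟨s, hs, rfl⟩)
    let S' : Subalgebra L₁ C :=
      { (Algebra.adjoin K₁ (Lnew : Set C)).toSubsemiring with
        algebraMap_mem' := hL₁ }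
    have hmemS' : ∀ z : C, z ∈ S' ↔ z ∈ Algebra.adjoin K₁ (Lnew : Set C) := fun _ => Iff.rfl
    have hS' : (⊤ : Subalgebra L₁ C) ≤ S' := by
      rw [← Compositum.adjoin_range_eq_top]
      refine Algebra.adjoin_le ?_
      rintro _ ⟨c, rfl⟩
      exact (hmemS' _).mpr (Algebra.subset_adjoin
        (IntermediateField.subset_adjoin K G (Or.inr ⟨c, rfl⟩)))
    exact eq_top_iff.mpr fun z _ => (hmemS' z).mp (hS' Algebra.mem_top)
  -- `L₁′° = Ostar` lies over `K₁°`
  have hOstarK₁ : Ostar.comap (algebraMap K₁ C) = O₁ := by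
    rw [IsScalarTower.algebraMap_eq K₁ L₁ C, ← ValuationSubring.comap_comap, hOstar, hO₁']
  -- `N′`: the same ring `N⋆`, as an algebra over `l′ ⊆ C`
  let Nnew : Subalgebra lnew C :=
    { carrier := {z | IsIntegral T z}
      mul_mem' := fun ha hb => ha.mul hb
      one_mem' := isIntegral_one
      add_mem' := fun ha hb => ha.add hb
      zero_mem' := isIntegral_zero
      algebraMap_mem' := fun c => by
        obtain ⟨c₀, hc₀⟩ := (hmem_lnew (c : C)).mp c.2
        change IsIntegral T (c : C)
        rw [← hc₀]
        exact hl₀int c₀ }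
  have hNnewO : Nnew.toSubring ≤ Ostar.toSubring := hNO
  -- the carrier of `N′` is the integral closure of the image of `A′`
  let S₁ : Subalgebra k C := A'.map (IsScalarTower.toAlgHom k K C)
  let S₂ : Subalgebra k C := (IsScalarTower.toAlgHom k T C).range
  have hmemS₂ : ∀ z : C, z ∈ S₂ ↔ ∃ t : T, algebraMap T C t = z := fun z =>
    AlgHom.mem_range (IsScalarTower.toAlgHom k T C)
  have hA'T : ∀ a : A', ∃ t : T, algebraMap T L₁ t = algebraMap K L₁ (a : K) := fun a => by
    have ha : algebraMap K L₁ (a : K) ∈ Set.range (algebraMap T L₁) := by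
      rw [hTcar]
      have hmem : IsScalarTower.toAlgHom k K L₁ a ∈ A'.map (IsScalarTower.toAlgHom k K L₁) :=
        Subalgebra.mem_map.mpr ⟨a, a.2, rfl⟩
      exact isIntegral_algebraMap (R := A'.map (IsScalarTower.toAlgHom k K L₁)) (x := ⟨_, hmem⟩)
    exact ha
  have h12 : S₁.toSubring ≤ S₂.toSubring := by
    intro z hz
    obtain ⟨a, ha, rfl⟩ := Subalgebra.mem_map.mp hz
    obtain ⟨t, ht⟩ := hA'T ⟨a, ha⟩
    refine (hmemS₂ _).mpr ⟨t, ?_⟩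
    change algebraMap T C t = algebraMap K C a
    rw [halgTC, ht, ← IsScalarTower.algebraMap_apply K L₁ C]
  have hTint : ∀ t : T, IsIntegral S₁ (algebraMap T C t) := fun t => by
    have h1 : IsIntegral (A'.map (IsScalarTower.toAlgHom k K L₁)) (algebraMap T L₁ t) := by
      have : algebraMap T L₁ t ∈ Set.range (algebraMap T L₁) := ⟨t, rfl⟩
      rw [hTcar] at this
      exact this
    have hmem : ∀ w : A'.map (IsScalarTower.toAlgHom k K L₁),
        (IsScalarTower.toAlgHom k L₁ C) (w : L₁) ∈ S₁ := fun w => by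
      obtain ⟨a, ha, hw⟩ := Subalgebra.mem_map.mp w.2
      refine Subalgebra.mem_map.mpr ⟨a, ha, ?_⟩
      rw [← hw]
      exact IsScalarTower.algebraMap_apply K L₁ C a
    let φ₁ : A'.map (IsScalarTower.toAlgHom k K L₁) →ₐ[k] S₁ :=
      ((IsScalarTower.toAlgHom k L₁ C).comp (A'.map (IsScalarTower.toAlgHom k K L₁)).val).codRestrict
        S₁ hmem
    have hcomp : (algebraMap S₁ C).comp (φ₁ : _ →+* S₁) =
        (algebraMap L₁ C).comp (algebraMap (A'.map (IsScalarTower.toAlgHom k K L₁)) L₁) :=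
      RingHom.ext fun _ => rfl
    have h2 := h1.map_of_comp_eq (φ₁ : _ →+* S₁) (algebraMap L₁ C) hcomp
    rw [← halgTC] at h2
    exact h2
  have hint₂ : ∀ z ∈ S₂, IsIntegral S₁ z := fun z hz => by
    obtain ⟨t, rfl⟩ := (hmemS₂ z).mp hz
    exact hTint t
  let eT : T ≃ₐ[k] S₂ :=
    AlgEquiv.ofInjective (IsScalarTower.toAlgHom k T C) (FaithfulSMul.algebraMap_injective T C)
  have heT₁ : (algebraMap S₂ C).comp (eT : T →+* S₂) = (RingHom.id C).comp (algebraMap T C) :=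
    RingHom.ext fun _ => rfl
  have heT₂ : (algebraMap T C).comp (eT.symm : S₂ →+* T) = (RingHom.id C).comp (algebraMap S₂ C) := by
    refine RingHom.ext fun z => ?_
    obtain ⟨t, rfl⟩ := eT.surjective z
    simp only [RingHom.coe_comp, RingHom.coe_coe, Function.comp_apply, AlgEquiv.symm_apply_apply,
      RingHom.id_apply]
    exact (congrArg (fun g : T →+* C => g t) heT₁).symm
  have hcar : (Nnew : Set C) = {z : C | IsIntegral (A'.map (IsScalarTower.toAlgHom k K C)) z} := by
    ext z
    change IsIntegral T z ↔ IsIntegral S₁ z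
    constructor
    · intro hz
      have hz₂ : IsIntegral S₂ z := hz.map_of_comp_eq (eT : T →+* S₂) (RingHom.id C) heT₁
      exact isIntegral_of_le_of_forall_isIntegral S₁ S₂ h12 hint₂ hz₂
    · intro hz
      have hz₂ : IsIntegral S₂ z := isIntegral_of_subalgebra_le S₁ S₂ h12 hz
      have := hz₂.map_of_comp_eq (eT.symm : S₂ →+* T) (RingHom.id C) heT₂
      exact this
  -- `N′` is finitely generated over `k` (E. Noether)
  have hNnew_fg : (Nnew.restrictScalars k).FG := by
    haveI hM : Module.Finite T (integralClosure T C) := NoetherFiniteIntegralClosure_holds k T L₁ C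
    have hft : Algebra.FiniteType k (integralClosure T C) :=
      Algebra.FiniteType.trans (S := T) inferInstance inferInstance
    have heq : Nnew.restrictScalars k = (integralClosure T C).restrictScalars k :=
      Subalgebra.ext fun _ => Iff.rfl
    rw [heq, Subalgebra.fg_iff_finiteType]
    exact hft
  -- `Frac N′ = C`
  have hNnew_fr : IsFractionRing Nnew C := by
    refine IsFractionRing.of_field Nnew C fun e => ?_
    obtain ⟨a, b, hb, he⟩ := hfrac e
    refine ⟨⟨ψ a, hψN a⟩, ⟨ψ b, hψN b⟩, ?_⟩
    change e = ψ a / ψ b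
    rw [eq_div_iff hb, he]
  -- the three local properties of the centre, with base field `l′ ≅ l₀`
  have hsm_new : Algebra.IsSmoothAt lnew (centreIdeal Nnew Ostar hNnewO) := by
    change Algebra.FormallySmooth lnew (Localization.AtPrime (centreIdeal Nnew Ostar hNnewO))
    letI : Algebra l₀ (Localization.AtPrime (centreIdeal Nnew Ostar hNnewO)) :=
      inferInstanceAs (Algebra l₀ (Localization.AtPrime P))
    haveI : Algebra.FormallySmooth l₀ (Localization.AtPrime (centreIdeal Nnew Ostar hNnewO)) :=
      hsmP
    exact formallySmooth_of_ringEquiv_base e_l.toRingEquiv fun _ => rfl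
  have hsep_new : Algebra.FormallySmooth lnew
      (ResidueField (Localization.AtPrime (centreIdeal Nnew Ostar hNnewO))) := by
    letI : Algebra l₀ (ResidueField (Localization.AtPrime (centreIdeal Nnew Ostar hNnewO))) :=
      inferInstanceAs (Algebra l₀ (ResidueField (Localization.AtPrime P)))
    haveI : Algebra.FormallySmooth l₀
        (ResidueField (Localization.AtPrime (centreIdeal Nnew Ostar hNnewO))) := hsepP
    exact formallySmooth_of_ringEquiv_base e_l.toRingEquiv fun _ => rfl
  have hreg_new : IsRegularLocalRing (Localization.AtPrime (centreIdeal Nnew Ostar hNnewO)) :=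
    hregP
  exact ⟨C, inferInstance, inferInstance, inferInstance, inferInstance, inferInstance,
    inferInstance, hfinC, hpiC, lnew, hfin_lnew, hpi_lnew, Lnew, hlLnew, hLnew_pi, hadj_new,
    A', hAA', hA'O, hA'fg, hA'fr, Ostar, hOstarK₁, Nnew, hNnewO, hcar, hNnew_fg, hNnew_fr,
    hsm_new, hsep_new, hreg_new⟩

/-- **The final enlargement of `l`** (Temkin 2013, proof of Thm. 4.1.1, end of Step 4, p. 49:
"In particular, `x₁` is `l`-smooth, and, replacing `l` with a purely inseparable extension, we
can also arrange that `x₁` is a simple `l`-smooth point"): the weak conclusion of Thm. 4.1.1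
(`Temkin2013DescentConclusionWeak`: centre `l`-smooth) implies the full conclusion
(`Temkin2013DescentConclusion`: centre `l`-smooth, simple and regular, for an enlarged `l`).
PROVED: `descentConclusion_of_isSmoothAt` with `l`, `N = Nr_{L₁}(X′)` instantiated.
[cite: Temkin2013, proof of Thm. 4.1.1 Step 4 (arXiv:0804.1554v3 p. 49)] -/
theorem Temkin2013DescentConclusion.of_weak (O : ValuationSubring K) (A : Subalgebra k K)
    (K₁ : Type u) [Field K₁] [Algebra K K₁] (O₁ : ValuationSubring K₁)
    (h : Temkin2013DescentConclusionWeak k K O A K₁ O₁) :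
    Temkin2013DescentConclusion k K O A K₁ O₁ := by
  obtain ⟨L₁, iF, iA1, iA, iAk, iT1, iT2, hfin, hpi, l, hlfin, hlpi, L, hlL, hLpi, hadj,
    A', hAA', hA'O, hA'fg, hA'fr, O₁', hO₁', N, hN, hNcar, hNfg, hNfr, hsm⟩ := h
  haveI := hfin
  haveI := hpi
  haveI := hlfin
  haveI := hlpi
  haveI := hNfr
  haveI : Algebra.FiniteType k N := (Subalgebra.fg_iff_finiteType _).mp hNfg
  have hlL' : Set.range (algebraMap l L₁) ⊆ L := by
    rintro _ ⟨c, rfl⟩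
    exact hlL c.2
  have hTcar : Set.range (algebraMap N L₁) =
      {y : L₁ | IsIntegral (A'.map (IsScalarTower.toAlgHom k K L₁)) y} := by
    rw [← hNcar]
    ext y
    constructor
    · rintro ⟨n, rfl⟩
      exact n.2
    · intro hy
      exact ⟨⟨y, hy⟩, rfl⟩
  have hTO : ∀ t : N, algebraMap N L₁ t ∈ O₁' := fun t => hN t.2
  exact descentConclusion_of_isSmoothAt O A K₁ O₁ L₁ l L hlL' hLpi hadj A' hAA' hA'O hA'fg hA'fr
    O₁' hO₁' N hTcar hTO (centreIdeal N O₁' hN) (fun _ => Iff.rfl) hsm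

end Literature.AlgebraicGeometry.Resolution

end
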